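import Summits.RiemannHypothesis.RiemannHypothesis.Theorems.WeilFormatCCinfArchMonomials
import Summits.RiemannHypothesis.RiemannHypothesis.Theorems.WeilFormatCArchNodeSumExpansion
import Summits.RiemannHypothesis.RiemannHypothesis.Theorems.WeilFormatCPolyWindowEntryBox
import HarnessLib

/-!
# Format C, design C∞ (E2, data side): kernel boxes for the COLLECTED IMAGE COEFFICIENTS `P_img(q; t, d)` (even sector)

Route context: Fourier–Galerkin / Schur-complement certificates of Weil positivity on a window ("format C", C∞ door;
cell memo `run/shared/lean/pub/rh-explicit/rh-explicit-weil-2/gen15/E2-PLAN-v2.md` §5; supporting stmt-RiemannHypothesis-0098;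
seat rh-explicit-weil-2).  `abs_re_image_pow_sub_collected_le` (weil-10, KERNEL-LEVER §21) writes the far image
`Re W_a(1x^q, χ_m)` as `(2a)^{-1/2}(−1)^m[Σ_d P₁(q,d)/m^d + log m·Σ_d P_L/m^d − C_m·Σ_d P_C/m^d + S_m·Σ_d P_S/m^d] ± …`
with every `P` an explicit fiber sum of printed constants.  This file evaluates those fiber sums in fixed-point interval
arithmetic from INPUT boxes (`ImgInputs`): `P ∋ π`, `AP ∋ a/π`, `A2P ∋ a/(2π)`, `QQ ∋ a²/(4π²)`,
`Pol ∋ 4C_q(e^{a/2} − e^{−a/2})` (polar constant, `WinPole.coshMomBox`/`expHalfBoxes`), `Kc ∋ κ_c = ½log(π/2a) − ½ψ(¼) − D_{−1}`,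
the real window brackets `KRe[k] ∋ Re(i^{k+1}·K_{q,k})` (`k ≤ q`; gen8 `WinMixed` prime/arch brackets, `tailBox`, `markovBox`),
a Bernoulli list and node-moment boxes — and proves membership for the VERBATIM (beta-reduced) fiber sums:
`mem_imgPureBox`, `mem_imgLogBox`, `mem_imgCosBox`, `mem_imgSinBox`.  Interval plumbing only; standard axioms; no RH claim.
-/

set_option autoImplicit false
-- `Summit.RiemannHypothesis.RiemannHypothesis.…` is the layout-mandated namespace (summit = problem name).
set_option linter.dupNamespace false

open Finset Complex MeasureTheory Set
open scoped Real ArithmeticFunction.vonMangoldt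

namespace Summit.RiemannHypothesis.RiemannHypothesis.Theorems.WeilFormatC

open Literature.NumberTheory.LFunctions Literature.NumberTheory.LFunctions.Yoshida1992 Literature.Analysis.SpecialFunctions
open Literature.Analysis.ValidatedNumerics Literature.Analysis.ValidatedNumerics.NumericsMP

namespace CinfCoeff

open WinConst (ratBox mem_ratBox mulRatBox mem_mulRatBox)
open WinEntry (sumBox mem_sumBox)

variable {S : ℕ}

/-! ## Generic pieces (image-side copies, distinct names from the row file) -/

/-- `x^n` by repeated outward multiplication. -/
def powI (S : ℕ) (X : MI) : ℕ → MI
  | 0 => MI.ofInt S 1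
  | n + 1 => (powI S X n).mul S X

/-- `powI ∋ x^n`. -/
theorem mem_powI (hS : 0 < S) {x : ℝ} {X : MI} (hx : MI.mem S x X) : ∀ n : ℕ, MI.mem S (x ^ n) (powI S X n)
  | 0 => by simpa [powI] using MI.mem_ofInt S 1
  | n + 1 => by rw [pow_succ, powI]; exact MI.mem_mul hS (mem_powI hS hx n) hx

/-- Filtered range sum `Σ_{k<n, p k} F k`. -/
def sumFI (S : ℕ) (n : ℕ) (p : ℕ → Prop) [DecidablePred p] (F : ℕ → MI) : MI :=
  sumBox S (fun k ↦ if p k then F k else MI.ofInt S 0) n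

/-- `sumFI ∋ Σ_{k ∈ (range n).filter p} g k`. -/
theorem mem_sumFI {n : ℕ} {p : ℕ → Prop} [DecidablePred p] {g : ℕ → ℝ} {F : ℕ → MI}
    (h : ∀ k, k < n → p k → MI.mem S (g k) (F k)) :
    MI.mem S (∑ k ∈ (Finset.range n).filter p, g k) (sumFI S n p F) := by
  rw [Finset.sum_filter, sumFI]
  refine mem_sumBox n fun k hk ↦ ?_
  by_cases hp : p k
  · rw [if_pos hp, if_pos hp]; exact h k hk hp
  · rw [if_neg hp, if_neg hp]; simpa using MI.mem_ofInt S 0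

/-- Filtered double sum over `[0,n) × [1,K]`. -/
def sumKN (S : ℕ) (n K : ℕ) (p : ℕ × ℕ → Prop) [DecidablePred p] (F : ℕ → ℕ → MI) : MI :=
  sumBox S (fun k ↦ sumBox S (fun j ↦ if p (k, j + 1) then F k (j + 1) else MI.ofInt S 0) K) n

/-- `sumKN ∋ Σ_{x ∈ (range n ×ˢ Icc 1 K).filter p} g x`. -/
theorem mem_sumKN {n K : ℕ} {p : ℕ × ℕ → Prop} [DecidablePred p] {g : ℕ × ℕ → ℝ} {F : ℕ → ℕ → MI}
    (h : ∀ k N, k < n → 1 ≤ N → N ≤ K → p (k, N) → MI.mem S (g (k, N)) (F k N)) :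
    MI.mem S (∑ x ∈ (Finset.range n ×ˢ Finset.Icc 1 K).filter p, g x) (sumKN S n K p F) := by
  rw [Finset.sum_filter, Finset.sum_product, sumKN]
  refine mem_sumBox n fun k hk ↦ ?_
  have hIcc : ∑ N ∈ Finset.Icc 1 K, (if p (k, N) then g (k, N) else 0)
      = ∑ j ∈ Finset.range K, (if p (k, j + 1) then g (k, j + 1) else 0) := by
    rw [← Finset.Ico_succ_right_eq_Icc, Order.succ_eq_add_one, Finset.sum_Ico_eq_sum_range,
      show K + 1 - 1 = K by omega]
    simp only [add_comm 1]
  rw [hIcc]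
  refine mem_sumBox K fun j hj ↦ ?_
  by_cases hp : p (k, j + 1)
  · rw [if_pos hp, if_pos hp]; exact h k (j + 1) hk (by omega) (by omega) hp
  · rw [if_neg hp, if_neg hp]; simpa using MI.mem_ofInt S 0

/-- Filtered double sum over `[0,n) × [0,R)`. -/
def sumKR (S : ℕ) (n R : ℕ) (p : ℕ × ℕ → Prop) [DecidablePred p] (F : ℕ → ℕ → MI) : MI :=
  sumBox S (fun k ↦ sumBox S (fun r ↦ if p (k, r) then F k r else MI.ofInt S 0) R) n

/-- `sumKR ∋ Σ_{x ∈ (range n ×ˢ range R).filter p} g x`. -/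
theorem mem_sumKR {n R : ℕ} {p : ℕ × ℕ → Prop} [DecidablePred p] {g : ℕ × ℕ → ℝ} {F : ℕ → ℕ → MI}
    (h : ∀ k r, k < n → r < R → p (k, r) → MI.mem S (g (k, r)) (F k r)) :
    MI.mem S (∑ x ∈ (Finset.range n ×ˢ Finset.range R).filter p, g x) (sumKR S n R p F) := by
  rw [Finset.sum_filter, Finset.sum_product, sumKR]
  refine mem_sumBox n fun k hk ↦ mem_sumBox R fun r hr ↦ ?_
  by_cases hp : p (k, r)
  · rw [if_pos hp, if_pos hp]; exact h k r hk hr hp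
  · rw [if_neg hp, if_neg hp]; simpa using MI.mem_ofInt S 0

/-- `Re(i^n)` as a rational. -/
def reIQ' (n : ℕ) : ℚ := if n % 4 = 0 then 1 else if n % 4 = 2 then -1 else 0

/-- `Im(i^n)` as a rational. -/
def imIQ' (n : ℕ) : ℚ := if n % 4 = 1 then 1 else if n % 4 = 3 then -1 else 0

/-- `Re(i^n) = reIQ' n`. -/
theorem reIQ'_cast (n : ℕ) : (I ^ n).re = ((reIQ' n : ℚ) : ℝ) := by
  rw [I_pow_eq_I_pow_mod_four n, reIQ']
  have h4 : n % 4 < 4 := Nat.mod_lt _ (by norm_num)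
  interval_cases hn : n % 4 <;> simp [pow_succ]

/-- `Im(i^n) = imIQ' n`. -/
theorem imIQ'_cast (n : ℕ) : (I ^ n).im = ((imIQ' n : ℚ) : ℝ) := by
  rw [I_pow_eq_I_pow_mod_four n, imIQ']
  have h4 : n % 4 < 4 := Nat.mod_lt _ (by norm_num)
  interval_cases hn : n % 4 <;> simp [pow_succ]

/-- `b_N` from a Bernoulli list (image-side copy). -/
def bNQ' (bt : List ℚ) (ν N : ℕ) : ℚ :=
  1 - 1 / (2 * (N : ℚ)) - (∑ l ∈ Finset.Icc 1 ν, bt.getD (l - 1) 0 / (2 * l) * 16 ^ l * (((N - 1).choose (2 * l - 1) : ℕ) : ℚ)) / 2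

/-- Cast of `bNQ'`. -/
theorem bNQ'_cast (bt : List ℚ) {ν : ℕ} (hbt : ∀ k, k < ν → bt.getD k 0 = bernoulli (2 * (k + 1))) (N : ℕ) :
    ((bNQ' bt ν N : ℚ) : ℝ) = 1 - 1 / (2 * (N : ℝ))
      - (∑ l ∈ Finset.Icc 1 ν, (bernoulli (2 * l) : ℝ) / (2 * l) * 16 ^ l * (((N - 1).choose (2 * l - 1) : ℕ) : ℝ)) / 2 := by
  rw [bNQ']; push_cast
  congr 2
  refine Finset.sum_congr rfl fun l hl ↦ ?_
  rw [Finset.mem_Icc] at hl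
  have h := hbt (l - 1) (by omega)
  rw [show l - 1 + 1 = l by omega] at h
  rw [h]

/-- `c_N = (1, 0, −1, 0)` by `N mod 4` (cosine pattern). -/
def cosQ (N : ℕ) : ℚ := if N % 4 = 0 then 1 else if N % 4 = 2 then -1 else 0

/-- `σ_N = (0, 1, 0, −1)` by `N mod 4` (sine pattern). -/
def sinQ (N : ℕ) : ℚ := if N % 4 = 1 then 1 else if N % 4 = 3 then -1 else 0

/-- Cast of `cosQ`. -/
theorem cosQ_cast (N : ℕ) : ((cosQ N : ℚ) : ℝ) = (if N % 4 = 0 then (1 : ℝ) else if N % 4 = 2 then -1 else 0) := by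
  unfold cosQ; split_ifs <;> simp

/-- Cast of `sinQ`. -/
theorem sinQ_cast (N : ℕ) : ((sinQ N : ℚ) : ℝ) = (if N % 4 = 1 then (1 : ℝ) else if N % 4 = 3 then -1 else 0) := by
  unfold sinQ; split_ifs <;> simp

/-! ## Inputs -/

/-- Input boxes for the images of the window power `x^q`. -/
structure ImgInputs where
  /-- `∋ π` -/
  P : MI
  /-- `∋ a/π` -/
  AP : MI
  /-- `∋ a/(2π)` -/
  A2P : MI
  /-- `∋ a²/(4π²)` -/
  QQ : MI
  /-- `∋ 4 C_q (e^{a/2} − e^{−a/2})`, `C_q = ∫_{−a}^{a} x^q cosh(x/2)` -/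
  Pol : MI
  /-- `∋ κ_c = ½log(π/2a) − ½Re ψ(¼) − D_{−1}` -/
  Kc : MI
  /-- `KRe[k] ∋ Re(i^{k+1} K_{q,k})`, the real window bracket, `k ≤ q` -/
  KRe : List MI
  /-- Bernoulli list, `bt[l−1] = B_{2l}` -/
  bt : List ℚ
  /-- node-moment boxes, `Dl[s] ∋ D_s(a)` -/
  Dl : List MI

/-- The complex window bracket `K_{q,k}` of `abs_re_image_pow_sub_monomials_le` (verbatim). -/
noncomputable def Kbracket (a : ℝ) (q k : ℕ) : ℂ :=
  (∑ n ∈ weilPrimeIndex a, ((Λ n : ℝ) / Real.sqrt n : ℂ) *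
      (((a : ℂ)) ^ (q - k) - (((-a : ℝ)) : ℂ) ^ (q - k)
        + (((a : ℂ)) ^ (q - k) - (((a - Real.log n : ℝ)) : ℂ) ^ (q - k))
        + ((((-a + Real.log n : ℝ)) : ℂ) ^ (q - k) - (((-a : ℝ)) : ℂ) ^ (q - k))))
    + ((∫ t in Ioc 0 (2 * a), weilArchDensity t *
        ((a ^ (q - k) - (a - t) ^ (q - k)) + ((-a + t) ^ (q - k) - (-a) ^ (q - k))) : ℝ) : ℂ)
    + (2 * ((∫ t in Ioi (2 * a), weilArchDensity t : ℝ) : ℂ) - (weilMarkovConstant a : ℂ))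
        * (((a : ℂ)) ^ (q - k) - (((-a : ℝ)) : ℂ) ^ (q - k))

/-- Validity of the image inputs for window `a`, power `q`, Stirling order `ν`, polar order `R`. -/
structure ImgInputsValid (S : ℕ) (a : ℚ) (q ν R : ℕ) (X : ImgInputs) : Prop where
  hP : MI.mem S Real.pi X.P
  hAP : MI.mem S ((a : ℝ) / Real.pi) X.AP
  hA2P : MI.mem S ((a : ℝ) / (2 * Real.pi)) X.A2P
  hQQ : MI.mem S ((a : ℝ) ^ 2 / (4 * Real.pi ^ 2)) X.QQ
  hPol : MI.mem S (4 * (∫ x in (-(a : ℝ))..(a : ℝ), x ^ q * Real.cosh (x / 2))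
            * (Real.exp ((a : ℝ) / 2) - Real.exp (-((a : ℝ) / 2)))) X.Pol
  hKc : MI.mem S (Real.log (π / (2 * (a : ℝ))) / 2 - reDigammaQuarter 0 / 2
            - ∑' l : ℕ, Real.exp (-(2 * (a : ℝ) * digammaNode l)) / digammaNode l) X.Kc
  hKRe : ∀ k, k ≤ q → MI.mem S ((I ^ (k + 1) * Kbracket (a : ℝ) q k).re) (X.KRe.getD k default)
  hbt : ∀ k, k < ν → X.bt.getD k 0 = bernoulli (2 * (k + 1))
  hD : ∀ s, s ≤ 2 * R + 1 →
    MI.mem S (∑' k : ℕ, Real.exp (-(2 * (a : ℝ) * digammaNode k)) * digammaNode k ^ s) (X.Dl.getD s default)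

/-! ## The four tag boxes -/

section Boxes

variable {a : ℚ} {q ν R : ℕ} {X : ImgInputs}

/-- `w_k = (−1)^k q^{(k)}` (rational). -/
def wQ (q k : ℕ) : ℚ := (-1) ^ k * (q.descFactorial k : ℚ)

/-- `α_k = (a^{q−k} − (−a)^{q−k}) Re(i^{k+1})` (rational). -/
def alphaQ (a : ℚ) (q k : ℕ) : ℚ := (a ^ (q - k) - (-a) ^ (q - k)) * reIQ' (k + 1)

/-- `β_k = (a^{q−k} + (−a)^{q−k}) Im(i^{k+1})` (rational). -/
def betaQ (a : ℚ) (q k : ℕ) : ℚ := (a ^ (q - k) + (-a) ^ (q - k)) * imIQ' (k + 1)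

/-- Cast of `wQ`. -/
theorem wQ_cast (q k : ℕ) : ((wQ q k : ℚ) : ℝ) = (-1 : ℝ) ^ k * (q.descFactorial k : ℝ) := by
  unfold wQ; push_cast; ring

/-- Cast of `alphaQ`. -/
theorem alphaQ_cast (a : ℚ) (q k : ℕ) :
    ((alphaQ a q k : ℚ) : ℝ) = ((a : ℝ) ^ (q - k) - (-(a : ℝ)) ^ (q - k)) * (I ^ (k + 1)).re := by
  unfold alphaQ; rw [reIQ'_cast]; push_cast; ring

/-- Cast of `betaQ`. -/
theorem betaQ_cast (a : ℚ) (q k : ℕ) :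
    ((betaQ a q k : ℚ) : ℝ) = ((a : ℝ) ^ (q - k) + (-(a : ℝ)) ^ (q - k)) * (I ^ (k + 1)).im := by
  unfold betaQ; rw [imIQ'_cast]; push_cast; ring

/-- **Pure-tag image coefficient box** `P₁(q, dd)`. -/
def imgPureBox (S : ℕ) (X : ImgInputs) (a : ℚ) (q ν K R J dd : ℕ) : MI :=
  (((((sumFI S J (fun r ↦ 2 * r + 2 = dd) (fun r ↦ mulRatBox (X.Pol.mul S (powI S X.QQ (r + 1))) ((-1 : ℚ) ^ r))).add
    (sumFI S (q + 1) (fun k ↦ k + 1 = dd)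
      (fun k ↦ (powI S X.AP (k + 1)).mul S
        (((mulRatBox (X.KRe.getD k default) (wQ q k)).add (mulRatBox X.Kc (wQ q k * alphaQ a q k))).add
          (mulRatBox (X.P.divNat 4) (wQ q k * betaQ a q k)))))).add
    (sumKN S (q + 1) K (fun x ↦ x.1 + 1 + x.2 = dd)
      (fun k N ↦ mulRatBox ((powI S X.AP (k + 1)).mul S (powI S X.A2P N)) (wQ q k * alphaQ a q k * cosQ N * bNQ' X.bt ν N)))).add
    (sumKR S (q + 1) R (fun x ↦ x.1 + 1 + (2 * x.2 + 2) = dd)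
      (fun k r ↦ mulRatBox (((powI S X.AP (k + 1)).mul S (X.Dl.getD (2 * r + 1) default)).mul S (powI S X.AP (2 * r + 2)))
        (wQ q k * alphaQ a q k * (-1 : ℚ) ^ r)))).add
    (sumKN S (q + 1) K (fun x ↦ x.1 + 1 + x.2 = dd)
      (fun k N ↦ mulRatBox ((powI S X.AP (k + 1)).mul S (powI S X.A2P N)) (wQ q k * betaQ a q k * sinQ N * bNQ' X.bt ν N)))).sub
    (sumKR S (q + 1) R (fun x ↦ x.1 + 1 + (2 * x.2 + 1) = dd)
      (fun k r ↦ mulRatBox (((powI S X.AP (k + 1)).mul S (X.Dl.getD (2 * r) default)).mul S (powI S X.AP (2 * r + 1)))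
        (wQ q k * betaQ a q k * (-1 : ℚ) ^ r)))

/-- **`imgPureBox ∋ P₁(q,dd)`**, the `dd`-th pure-tag fiber sum of `abs_re_image_pow_sub_collected_le` (beta-reduced, with
`K_{q,k} = Kbracket a q k`). -/
theorem mem_imgPureBox (hS : 0 < S) (hX : ImgInputsValid S a q ν R X) (K J dd : ℕ) :
    MI.mem S
      ((∑ r ∈ (Finset.range J).filter (fun r ↦ 2 * r + 2 = dd),
          (4 * (∫ x in (-(a : ℝ))..(a : ℝ), x ^ q * Real.cosh (x / 2)) * (Real.exp ((a : ℝ) / 2) - Real.exp (-((a : ℝ) / 2))))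
            * ((-1 : ℝ) ^ r * ((a : ℝ) ^ 2 / (4 * π ^ 2)) ^ (r + 1)))
        + (∑ k ∈ (Finset.range (q + 1)).filter (fun k ↦ k + 1 = dd),
            (((-1 : ℝ) ^ k * (q.descFactorial k : ℝ) * ((a : ℝ) / π) ^ (k + 1)) * (I ^ (k + 1) * Kbracket (a : ℝ) q k).re
            + ((-1 : ℝ) ^ k * (q.descFactorial k : ℝ) * ((a : ℝ) / π) ^ (k + 1))
              * (((a : ℝ) ^ (q - k) - (-(a : ℝ)) ^ (q - k)) * (I ^ (k + 1)).re)
              * (Real.log (π / (2 * (a : ℝ))) / 2 - reDigammaQuarter 0 / 2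
                  - ∑' l : ℕ, Real.exp (-(2 * (a : ℝ) * digammaNode l)) / digammaNode l)
            + ((-1 : ℝ) ^ k * (q.descFactorial k : ℝ) * ((a : ℝ) / π) ^ (k + 1))
              * (((a : ℝ) ^ (q - k) + (-(a : ℝ)) ^ (q - k)) * (I ^ (k + 1)).im) * (π / 4)))
        + (∑ x ∈ (Finset.range (q + 1) ×ˢ Finset.Icc 1 K).filter (fun x ↦ x.1 + 1 + x.2 = dd),
            ((-1 : ℝ) ^ x.1 * (q.descFactorial x.1 : ℝ) * ((a : ℝ) / π) ^ (x.1 + 1))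
              * (((a : ℝ) ^ (q - x.1) - (-(a : ℝ)) ^ (q - x.1)) * (I ^ (x.1 + 1)).re)
              * ((if x.2 % 4 = 0 then (1 : ℝ) else if x.2 % 4 = 2 then -1 else 0)
                  * (1 - 1 / (2 * (x.2 : ℝ))
                      - (∑ l ∈ Finset.Icc 1 ν, (bernoulli (2 * l) : ℝ) / (2 * l) * 16 ^ l
                          * (((x.2 - 1).choose (2 * l - 1) : ℕ) : ℝ)) / 2)
                  * ((a : ℝ) / (2 * π)) ^ x.2))
        + (∑ x ∈ (Finset.range (q + 1) ×ˢ Finset.range R).filter (fun x ↦ x.1 + 1 + (2 * x.2 + 2) = dd),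
            ((-1 : ℝ) ^ x.1 * (q.descFactorial x.1 : ℝ) * ((a : ℝ) / π) ^ (x.1 + 1))
              * (((a : ℝ) ^ (q - x.1) - (-(a : ℝ)) ^ (q - x.1)) * (I ^ (x.1 + 1)).re)
              * ((-1 : ℝ) ^ x.2 * (∑' l : ℕ, Real.exp (-(2 * (a : ℝ) * digammaNode l)) * digammaNode l ^ (2 * x.2 + 1))
                  * ((a : ℝ) / π) ^ (2 * x.2 + 2)))
        + (∑ x ∈ (Finset.range (q + 1) ×ˢ Finset.Icc 1 K).filter (fun x ↦ x.1 + 1 + x.2 = dd),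
            ((-1 : ℝ) ^ x.1 * (q.descFactorial x.1 : ℝ) * ((a : ℝ) / π) ^ (x.1 + 1))
              * (((a : ℝ) ^ (q - x.1) + (-(a : ℝ)) ^ (q - x.1)) * (I ^ (x.1 + 1)).im)
              * ((if x.2 % 4 = 1 then (1 : ℝ) else if x.2 % 4 = 3 then -1 else 0)
                  * (1 - 1 / (2 * (x.2 : ℝ))
                      - (∑ l ∈ Finset.Icc 1 ν, (bernoulli (2 * l) : ℝ) / (2 * l) * 16 ^ l
                          * (((x.2 - 1).choose (2 * l - 1) : ℕ) : ℝ)) / 2)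
                  * ((a : ℝ) / (2 * π)) ^ x.2))
        - (∑ x ∈ (Finset.range (q + 1) ×ˢ Finset.range R).filter (fun x ↦ x.1 + 1 + (2 * x.2 + 1) = dd),
            ((-1 : ℝ) ^ x.1 * (q.descFactorial x.1 : ℝ) * ((a : ℝ) / π) ^ (x.1 + 1))
              * (((a : ℝ) ^ (q - x.1) + (-(a : ℝ)) ^ (q - x.1)) * (I ^ (x.1 + 1)).im)
              * ((-1 : ℝ) ^ x.2 * (∑' l : ℕ, Real.exp (-(2 * (a : ℝ) * digammaNode l)) * digammaNode l ^ (2 * x.2))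
                  * ((a : ℝ) / π) ^ (2 * x.2 + 1))))
      (imgPureBox S X a q ν K R J dd) := by
  have hπ : Real.pi ≠ 0 := Real.pi_ne_zero
  set κ : ℝ := Real.log (π / (2 * (a : ℝ))) / 2 - reDigammaQuarter 0 / 2
      - ∑' l : ℕ, Real.exp (-(2 * (a : ℝ) * digammaNode l)) / digammaNode l with hκ
  set Pc : ℝ := 4 * (∫ x in (-(a : ℝ))..(a : ℝ), x ^ q * Real.cosh (x / 2))
      * (Real.exp ((a : ℝ) / 2) - Real.exp (-((a : ℝ) / 2))) with hPc
  unfold imgPureBox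
  refine MI.mem_sub (MI.mem_add (MI.mem_add (MI.mem_add (MI.mem_add ?_ ?_) ?_) ?_) ?_) ?_
  · -- polar
    refine mem_sumFI fun r _ _ ↦ ?_
    have hm := mem_mulRatBox (MI.mem_mul hS hX.hPol (mem_powI hS hX.hQQ (r + 1))) ((-1 : ℚ) ^ r)
    convert hm using 1
    push_cast; ring
  · -- k-bracket
    refine mem_sumFI fun k hk _ ↦ ?_
    have hK := hX.hKRe k (by omega)
    have h1 := mem_mulRatBox hK (wQ q k)
    have h2 := mem_mulRatBox hX.hKc (wQ q k * alphaQ a q k)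
    have h3 := mem_mulRatBox (MI.mem_divNat hX.hP (n := 4) (by norm_num)) (wQ q k * betaQ a q k)
    have hm := MI.mem_mul hS (mem_powI hS hX.hAP (k + 1)) (MI.mem_add (MI.mem_add h1 h2) h3)
    convert hm using 1
    push_cast
    rw [wQ_cast, alphaQ_cast, betaQ_cast]
    ring
  · -- α × cosine Stirling
    refine mem_sumKN fun k N _ _ _ _ ↦ ?_
    have hm := mem_mulRatBox (MI.mem_mul hS (mem_powI hS hX.hAP (k + 1)) (mem_powI hS hX.hA2P N))
      (wQ q k * alphaQ a q k * cosQ N * bNQ' X.bt ν N)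
    convert hm using 1
    push_cast
    rw [wQ_cast, alphaQ_cast, cosQ_cast, bNQ'_cast X.bt hX.hbt]
    ring
  · -- α × odd node moments
    refine mem_sumKR fun k r _ hr _ ↦ ?_
    have hDm := hX.hD (2 * r + 1) (by omega)
    have hm := mem_mulRatBox (MI.mem_mul hS (MI.mem_mul hS (mem_powI hS hX.hAP (k + 1)) hDm)
      (mem_powI hS hX.hAP (2 * r + 2))) (wQ q k * alphaQ a q k * (-1 : ℚ) ^ r)
    convert hm using 1
    push_cast
    rw [wQ_cast, alphaQ_cast]
    ring
  · -- β × sine Stirling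
    refine mem_sumKN fun k N _ _ _ _ ↦ ?_
    have hm := mem_mulRatBox (MI.mem_mul hS (mem_powI hS hX.hAP (k + 1)) (mem_powI hS hX.hA2P N))
      (wQ q k * betaQ a q k * sinQ N * bNQ' X.bt ν N)
    convert hm using 1
    push_cast
    rw [wQ_cast, betaQ_cast, sinQ_cast, bNQ'_cast X.bt hX.hbt]
    ring
  · -- β × even node moments
    refine mem_sumKR fun k r _ hr _ ↦ ?_
    have hDm := hX.hD (2 * r) (by omega)
    have hm := mem_mulRatBox (MI.mem_mul hS (MI.mem_mul hS (mem_powI hS hX.hAP (k + 1)) hDm)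
      (mem_powI hS hX.hAP (2 * r + 1))) (wQ q k * betaQ a q k * (-1 : ℚ) ^ r)
    convert hm using 1
    push_cast
    rw [wQ_cast, betaQ_cast]
    ring

/-- **Log-tag image coefficient box**: `Σ_{k+1=dd} w_k (a/π)^{k+1} α_k / 2`. -/
def imgLogBox (S : ℕ) (X : ImgInputs) (a : ℚ) (q dd : ℕ) : MI :=
  sumFI S (q + 1) (fun k ↦ k + 1 = dd) (fun k ↦ mulRatBox (powI S X.AP (k + 1)) (wQ q k * alphaQ a q k / 2))

/-- **`imgLogBox ∋ P_L(q,dd)`** (verbatim, beta-reduced). -/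
theorem mem_imgLogBox (hS : 0 < S) (hX : ImgInputsValid S a q ν R X) (dd : ℕ) :
    MI.mem S (∑ k ∈ (Finset.range (q + 1)).filter (fun k ↦ k + 1 = dd),
        ((-1 : ℝ) ^ k * (q.descFactorial k : ℝ) * ((a : ℝ) / π) ^ (k + 1))
          * (((a : ℝ) ^ (q - k) - (-(a : ℝ)) ^ (q - k)) * (I ^ (k + 1)).re) / 2)
      (imgLogBox S X a q dd) := by
  unfold imgLogBox
  refine mem_sumFI fun k _ _ ↦ ?_
  have hm := mem_mulRatBox (mem_powI hS hX.hAP (k + 1)) (wQ q k * alphaQ a q k / 2)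
  convert hm using 1
  push_cast; rw [wQ_cast, alphaQ_cast]; ring

/-- **Cosine-tag image coefficient box**: `Σ_{k+1=dd} w_k (a/π)^{k+1} α_k` (the family carries the sign, `φ = −C_m`). -/
def imgCosBox (S : ℕ) (X : ImgInputs) (a : ℚ) (q dd : ℕ) : MI :=
  sumFI S (q + 1) (fun k ↦ k + 1 = dd) (fun k ↦ mulRatBox (powI S X.AP (k + 1)) (wQ q k * alphaQ a q k))

/-- **`imgCosBox ∋ P_C(q,dd)`** (verbatim, beta-reduced). -/
theorem mem_imgCosBox (hS : 0 < S) (hX : ImgInputsValid S a q ν R X) (dd : ℕ) :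
    MI.mem S (∑ k ∈ (Finset.range (q + 1)).filter (fun k ↦ k + 1 = dd),
        ((-1 : ℝ) ^ k * (q.descFactorial k : ℝ) * ((a : ℝ) / π) ^ (k + 1))
          * (((a : ℝ) ^ (q - k) - (-(a : ℝ)) ^ (q - k)) * (I ^ (k + 1)).re))
      (imgCosBox S X a q dd) := by
  unfold imgCosBox
  refine mem_sumFI fun k _ _ ↦ ?_
  have hm := mem_mulRatBox (mem_powI hS hX.hAP (k + 1)) (wQ q k * alphaQ a q k)
  convert hm using 1
  push_cast; rw [wQ_cast, alphaQ_cast]; ring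

/-- **Sine-tag image coefficient box**: `Σ_{k+1=dd} w_k (a/π)^{k+1} β_k`. -/
def imgSinBox (S : ℕ) (X : ImgInputs) (a : ℚ) (q dd : ℕ) : MI :=
  sumFI S (q + 1) (fun k ↦ k + 1 = dd) (fun k ↦ mulRatBox (powI S X.AP (k + 1)) (wQ q k * betaQ a q k))

/-- **`imgSinBox ∋ P_S(q,dd)`** (verbatim, beta-reduced). -/
theorem mem_imgSinBox (hS : 0 < S) (hX : ImgInputsValid S a q ν R X) (dd : ℕ) :
    MI.mem S (∑ k ∈ (Finset.range (q + 1)).filter (fun k ↦ k + 1 = dd),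
        ((-1 : ℝ) ^ k * (q.descFactorial k : ℝ) * ((a : ℝ) / π) ^ (k + 1))
          * (((a : ℝ) ^ (q - k) + (-(a : ℝ)) ^ (q - k)) * (I ^ (k + 1)).im))
      (imgSinBox S X a q dd) := by
  unfold imgSinBox
  refine mem_sumFI fun k _ _ ↦ ?_
  have hm := mem_mulRatBox (mem_powI hS hX.hAP (k + 1)) (wQ q k * betaQ a q k)
  convert hm using 1
  push_cast; rw [wQ_cast, betaQ_cast]; ring

end Boxes

end CinfCoeff

end Summit.RiemannHypothesis.RiemannHypothesis.Theorems.WeilFormatC
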